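/-
Copyright (c) 2026 the pub-hodgecm-mathlib formalisation cell (harness21).  Prover seat hodgecm-mathlib-K2E3-p31 (g3) on S4 dealer K2E2-plan (g7)'s DEAL (d′)
2026-09-05T01:47:05Z (chair K2-lead (g2) VALVE 13), Track B «K2-LIT», R90-TF section S4 (h413 = `stmt-HodgeConjecture-24833`), T-WIF road, (L2) ⇒ (L1) «BOREL TRANSVERSAL +
SHEET MEASURES», FILE 2∕2 (the sheet measure `λ`; FILE 1∕2 = `R90S4NormSectionSheets`, split off by the 400-line rule) for R90-C131-p03 (g3)'s (B1) assembly (census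
`R90/R90-C131-p03/g3/CENSUS-B1-assembly.md` §2).  THEOREMS ONLY (no `def`, no `instance`, no notation, no named-fact hypothesis, no `sorry`); ★-only imports.
-/
import Summits.HodgeConjecture.HodgeConjecture.Theorems.R90S4NormSectionSheets   -- FILE 1∕2 (this seat): `measurableEmbedding_normSheet`, `normSheet_injective`, `disjoint_range_normSheet`, `measurableSet_setOf_isRegularElt_subgroup`, the (L1) letters
import HarnessLib

/-!
# R90-TF · S4 «Ch. 13.1–2», T-WIF road, (L2) ⇒ (L1) FILE 2∕2: THE SHEET MEASURE `λ = Σ_{u ∈ R} (σ_u)_*(t_T|_{T^{reg}})` ON `T̃` CARRIED BY THE BOREL TRANSVERSAL `B₀`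
# (Rogawski 1990, §12.5 p. 186 «`∫_{Z̃T̃ᴺ∖T̃} … dδ`»; Harish-Chandra 1970, Lemmas 22 ∕ 42)

Cell `hodgecm-mathlib`, crux H413 (`stmt-HodgeConjecture-24833`, lane `--supports … --as helper`), route of record `HCCMUnconditional` (no route verbs;
count-neutral).  Programme R90-TF, section S4 = [Rogawski1990] Ch. 13.1–13.2; S4 dealer K2E2-plan (g7), S4-R33 (a), DEAL (d′); consumer R90-C131-p03 (g3)'s (B1-T) ∕ (B1-Σ)
(★ M2♭ `R90S4EquivariantFamilyTubeJacobian`'s `lam`, `hJac`, `[SigmaFinite lam]`).  Setting and letters = FILE 1∕2 ★ `R90S4NormSectionSheets` VERBATIM: `γ ∈ G_v` regular,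
`T = Cent_{G_v}(γ)` (`hT`), the (L2) Borel norm section `(s, hsm, hsT, hsN)` (K2E5-p17), the sheet map `(σ, hσ)` (FILE 1 §0), the kernel transversal `(R, hRT)` (★ p863871),
and ANY measure `t_T` on `T`.

THE POINT.  `λ := Σ_{u ∈ R} (σ_u)_*(t_T|_{T^{reg}})` is a measure on `T̃ = Cent_{G̃_v}(γ)` — written INLINE (no `def`) as
`∑ u ∈ R, Measure.map (σ u) (tT.restrict {t | IsRegularElt (t : G_v).val})` — and, because every sheet `σ_u` (`u ∈ R`) is a measurable embedding of the standard Borel `T`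
(FILE 1 `measurableEmbedding_normSheet`) and distinct sheets are disjoint (FILE 1 `disjoint_range_normSheet`):
* **`lintegral_normSheets`** `∫⁻ F dλ = Σ_{u ∈ R} ∫⁻_{T^{reg}} F(σ_u t) dt_T` (no measurability of `F`); **`integral_normSheets`** (Bochner, `F` `λ`-integrable);
* `normSheets_apply` `λ(A) = Σ_u t_T(σ_u⁻¹A ∩ T^{reg})` for EVERY `A`; **`setLIntegral_normSheets_image`** `∫⁻_{σ_u(A)} F dλ = ∫⁻_{A ∩ T^{reg}} F(σ_u t) dt_T` — ADDITIVITY OVER THE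
  SHEETS, the conversion of the per-sheet twisted tube Jacobian (J̃♭)_i «`ν(Ψ(A₀ × σ_u V)) = μ₀(A₀) ∫⁻_V W dt_T`» into ★ M2♭'s `hJac` on `lam := λ`;
* `normSheets_apply_compl_normTransversal` `λ(B₀ᶜ) = 0` (`B₀ = ⋃_{u ∈ R} σ_u(T^{reg})`, ★ M2♭'s «carried by `S₀`»); `sigmaFinite_normSheets` (σ-finite `t_T` ⇒ σ-finite `λ`);
  `sigmaFinite_finsetSum` (generic: a finite sum of σ-finite measures is σ-finite).

HONEST LABEL: HC_CM is proved only modulo the 7 printed citations (2 remaining named inputs: hLiu418 = stmt-HodgeConjecture-24832, h413 =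
stmt-HodgeConjecture-24833) until rung 0 closes.  Pure measure plumbing; `λ` is an input of the (B1) assembly behind the OPEN (W-NP); this file discharges no socket by itself
(REL ≠ ★ ≠ BUILT).

[cite: Rogawski1990, §12.5 p. 186; §3.11 Prop. 3.11.1 (a)–(c) pp. 34–35] [cite: HarishChandra1970, Lemma 22; Lemma 42] [cite: Kechris1995, Thm. 15.1]
-/

set_option autoImplicit false
-- the mandated namespace repeats the single-problem summit's segment (`HodgeConjecture.HodgeConjecture`)
set_option linter.dupNamespace false

noncomputable section

open MeasureTheory Measure Set Filter Topology Function NumberField IsDedekindDomain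
open scoped ENNReal NNReal MatrixGroups

namespace Summit.HodgeConjecture.HodgeConjecture.R90.S4

open Literature.NumberTheory.Rogawski1990 Literature.NumberTheory.Rogawski1990.Ch4Sec10
open Literature.NumberTheory.Automorphic Literature.NumberTheory.Automorphic.UnitaryGroup

variable (L : Type) [Field L] [NumberField L] [IsCMField L] (v : HeightOneSpectrum (𝓞 ↥(maximalRealSubfield L)))

/-! ## §1 The sheet measure `λ = Σ_{u ∈ R} (σ_u)_*(t_T|_{T^{reg}})` on `T̃`, for ANY measure `t_T` on `T` -/

/-- A finite sum of σ-finite measures is σ-finite. [folklore] -/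
theorem sigmaFinite_finsetSum {α ι : Type*} {m : MeasurableSpace α} (S : Finset ι) (μ : ι → Measure α)
    (h : ∀ i ∈ S, SigmaFinite (μ i)) : SigmaFinite (∑ i ∈ S, μ i) := by
  induction S using Finset.cons_induction with
  | empty =>
    rw [Finset.sum_empty]
    infer_instance
  | cons a S ha ih =>
    rw [Finset.sum_cons]
    haveI := h a (Finset.mem_cons.2 (Or.inl rfl))
    haveI := ih fun i hi => h i (Finset.mem_cons.2 (Or.inr hi))
    infer_instance

/-- **`∫⁻ F dλ = Σ_{u ∈ R} ∫⁻_{T^{reg}} F(σ_u t) dt_T(t)`** — the lower integral against the sheet measure, sheet by sheet (no measurability of `F`: each `σ_u` is a measurable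
embedding, Mathlib `MeasurableEmbedding.lintegral_map`). [cite: Rogawski1990, §12.5 p. 186] [cite: HarishChandra1970, Lemma 42] -/
theorem lintegral_normSheets [MeasurableSpace (GtLoc L v)] [BorelSpace (GtLoc L v)] [SecondCountableTopology (GtLoc L v)] [T2Space (GtLoc L v)]
    [MeasurableSpace (Gqs L v)] [BorelSpace (Gqs L v)]
    {γ : Gqs L v} {T : Subgroup (Gqs L v)} (hT : T = Subgroup.centralizer ({γ} : Set (Gqs L v))) {s : ↥T → GtLoc L v} (hsm : Measurable s)
    (hsT : ∀ t, s t ∈ Subgroup.centralizer ({(γ.val : GtLoc L v)} : Set (GtLoc L v)))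
    (hsN : ∀ t, epsNorm (epsLoc L (splitFormGL L) v) (s t) = ((t : Gqs L v)).val)
    {σ : GtLoc L v → ↥T → ↥(Subgroup.centralizer ({(γ.val : GtLoc L v)} : Set (GtLoc L v)))}
    (hσ : ∀ u ∈ Subgroup.centralizer ({(γ.val : GtLoc L v)} : Set (GtLoc L v)), ∀ t : ↥T,
      ((σ u t : ↥(Subgroup.centralizer ({(γ.val : GtLoc L v)} : Set (GtLoc L v)))) : GtLoc L v) = s t * u)
    (R : Finset (GtLoc L v))
    (hRT : ∀ r ∈ R, r ∈ Subgroup.centralizer ({(γ.val : GtLoc L v)} : Set (GtLoc L v)) ∧ epsNorm (epsLoc L (splitFormGL L) v) r = 1)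
    (tT : Measure ↥T) (F : ↥(Subgroup.centralizer ({(γ.val : GtLoc L v)} : Set (GtLoc L v))) → ℝ≥0∞) :
    ∫⁻ x, F x ∂(∑ u ∈ R, Measure.map (σ u) (tT.restrict {t : ↥T | IsRegularElt (((t : Gqs L v)).val : GtLoc L v)})) =
      ∑ u ∈ R, ∫⁻ t in {t : ↥T | IsRegularElt (((t : Gqs L v)).val : GtLoc L v)}, F (σ u t) ∂tT := by
  rw [lintegral_finsetSum_measure]
  refine Finset.sum_congr rfl fun u hu => ?_
  exact (measurableEmbedding_normSheet L v hT hsm hsT hsN hσ (hRT u hu).1).lintegral_map F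

/-- **`∫ F dλ = Σ_{u ∈ R} ∫_{T^{reg}} F(σ_u t) dt_T(t)`** for `F` `λ`-integrable (Bochner; Mathlib `integral_finsetSum_measure` + `MeasurableEmbedding.integral_map`) — the explicit
reference measure of the census, §2: «`∫_{B₀} F dλ = Σ_u ∫_{T^{reg}} F(s t · u) dt_T`». [cite: Rogawski1990, §12.5 p. 186] [cite: HarishChandra1970, Lemma 42] -/
theorem integral_normSheets [MeasurableSpace (GtLoc L v)] [BorelSpace (GtLoc L v)] [SecondCountableTopology (GtLoc L v)] [T2Space (GtLoc L v)]
    [MeasurableSpace (Gqs L v)] [BorelSpace (Gqs L v)]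
    {γ : Gqs L v} {T : Subgroup (Gqs L v)} (hT : T = Subgroup.centralizer ({γ} : Set (Gqs L v))) {s : ↥T → GtLoc L v} (hsm : Measurable s)
    (hsT : ∀ t, s t ∈ Subgroup.centralizer ({(γ.val : GtLoc L v)} : Set (GtLoc L v)))
    (hsN : ∀ t, epsNorm (epsLoc L (splitFormGL L) v) (s t) = ((t : Gqs L v)).val)
    {σ : GtLoc L v → ↥T → ↥(Subgroup.centralizer ({(γ.val : GtLoc L v)} : Set (GtLoc L v)))}
    (hσ : ∀ u ∈ Subgroup.centralizer ({(γ.val : GtLoc L v)} : Set (GtLoc L v)), ∀ t : ↥T,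
      ((σ u t : ↥(Subgroup.centralizer ({(γ.val : GtLoc L v)} : Set (GtLoc L v)))) : GtLoc L v) = s t * u)
    (R : Finset (GtLoc L v))
    (hRT : ∀ r ∈ R, r ∈ Subgroup.centralizer ({(γ.val : GtLoc L v)} : Set (GtLoc L v)) ∧ epsNorm (epsLoc L (splitFormGL L) v) r = 1)
    (tT : Measure ↥T) {E : Type*} [NormedAddCommGroup E] [NormedSpace ℝ E] {F : ↥(Subgroup.centralizer ({(γ.val : GtLoc L v)} : Set (GtLoc L v))) → E}
    (hF : Integrable F (∑ u ∈ R, Measure.map (σ u) (tT.restrict {t : ↥T | IsRegularElt (((t : Gqs L v)).val : GtLoc L v)}))) :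
    ∫ x, F x ∂(∑ u ∈ R, Measure.map (σ u) (tT.restrict {t : ↥T | IsRegularElt (((t : Gqs L v)).val : GtLoc L v)})) =
      ∑ u ∈ R, ∫ t in {t : ↥T | IsRegularElt (((t : Gqs L v)).val : GtLoc L v)}, F (σ u t) ∂tT := by
  rw [integral_finsetSum_measure (integrable_finsetSum_measure.1 hF)]
  refine Finset.sum_congr rfl fun u hu => ?_
  exact (measurableEmbedding_normSheet L v hT hsm hsT hsN hσ (hRT u hu).1).integral_map F

/-- **`λ(A) = Σ_{u ∈ R} t_T(σ_u⁻¹ A ∩ T^{reg})`** for EVERY `A ⊆ T̃` (no measurability: `MeasurableEmbedding.map_apply`). [cite: Rogawski1990, §12.5 p. 186] -/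
theorem normSheets_apply (hns : ∀ w : PlacesOver L v, IsCMField.complexConj L • w.1 = w.1)
    [MeasurableSpace (GtLoc L v)] [BorelSpace (GtLoc L v)] [SecondCountableTopology (GtLoc L v)] [T2Space (GtLoc L v)]
    [MeasurableSpace (Gqs L v)] [BorelSpace (Gqs L v)]
    {γ : Gqs L v} {T : Subgroup (Gqs L v)} (hT : T = Subgroup.centralizer ({γ} : Set (Gqs L v))) {s : ↥T → GtLoc L v} (hsm : Measurable s)
    (hsT : ∀ t, s t ∈ Subgroup.centralizer ({(γ.val : GtLoc L v)} : Set (GtLoc L v)))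
    (hsN : ∀ t, epsNorm (epsLoc L (splitFormGL L) v) (s t) = ((t : Gqs L v)).val)
    {σ : GtLoc L v → ↥T → ↥(Subgroup.centralizer ({(γ.val : GtLoc L v)} : Set (GtLoc L v)))}
    (hσ : ∀ u ∈ Subgroup.centralizer ({(γ.val : GtLoc L v)} : Set (GtLoc L v)), ∀ t : ↥T,
      ((σ u t : ↥(Subgroup.centralizer ({(γ.val : GtLoc L v)} : Set (GtLoc L v)))) : GtLoc L v) = s t * u)
    (R : Finset (GtLoc L v))
    (hRT : ∀ r ∈ R, r ∈ Subgroup.centralizer ({(γ.val : GtLoc L v)} : Set (GtLoc L v)) ∧ epsNorm (epsLoc L (splitFormGL L) v) r = 1)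
    (tT : Measure ↥T) (A : Set ↥(Subgroup.centralizer ({(γ.val : GtLoc L v)} : Set (GtLoc L v)))) :
    (∑ u ∈ R, Measure.map (σ u) (tT.restrict {t : ↥T | IsRegularElt (((t : Gqs L v)).val : GtLoc L v)})) A =
      ∑ u ∈ R, tT (σ u ⁻¹' A ∩ {t : ↥T | IsRegularElt (((t : Gqs L v)).val : GtLoc L v)}) := by
  rw [Measure.finsetSum_apply]
  refine Finset.sum_congr rfl fun u hu => ?_
  rw [(measurableEmbedding_normSheet L v hT hsm hsT hsN hσ (hRT u hu).1).map_apply,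
    Measure.restrict_apply' (measurableSet_setOf_isRegularElt_subgroup L v hns T)]

/-- **ADDITIVITY OVER THE SHEETS: `∫⁻_{σ_u(A)} F dλ = ∫⁻_{A ∩ T^{reg}} F(σ_u t) dt_T(t)`** for `u ∈ R` and Borel `A ⊆ T` — `λ` restricted to the `u`-th sheet is the
push-forward of `t_T|_{T^{reg}}` (the other sheets miss `σ_u(A)`: `disjoint_range_normSheet`; `σ_u` is injective: Mathlib `Set.indicator_image`).  This is the conversion of
the per-sheet twisted tube Jacobian (J̃♭)_i «`ν(Ψ(A₀ × σ_u V)) = μ₀(A₀) ∫⁻_V W dt_T`» into ★ M2♭ `R90S4EquivariantFamilyTubeJacobian`'s `hJac` on `lam := λ`.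
[cite: Rogawski1990, §12.5 p. 186] [cite: HarishChandra1970, Lemma 22; Lemma 42] -/
theorem setLIntegral_normSheets_image
    [MeasurableSpace (GtLoc L v)] [BorelSpace (GtLoc L v)] [SecondCountableTopology (GtLoc L v)] [T2Space (GtLoc L v)]
    [MeasurableSpace (Gqs L v)] [BorelSpace (Gqs L v)]
    {γ : Gqs L v} (hγ : IsRegularElt (γ.val : GtLoc L v)) {T : Subgroup (Gqs L v)} (hT : T = Subgroup.centralizer ({γ} : Set (Gqs L v)))
    {s : ↥T → GtLoc L v} (hsm : Measurable s)
    (hsT : ∀ t, s t ∈ Subgroup.centralizer ({(γ.val : GtLoc L v)} : Set (GtLoc L v)))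
    (hsN : ∀ t, epsNorm (epsLoc L (splitFormGL L) v) (s t) = ((t : Gqs L v)).val)
    {σ : GtLoc L v → ↥T → ↥(Subgroup.centralizer ({(γ.val : GtLoc L v)} : Set (GtLoc L v)))}
    (hσ : ∀ u ∈ Subgroup.centralizer ({(γ.val : GtLoc L v)} : Set (GtLoc L v)), ∀ t : ↥T,
      ((σ u t : ↥(Subgroup.centralizer ({(γ.val : GtLoc L v)} : Set (GtLoc L v)))) : GtLoc L v) = s t * u)
    (R : Finset (GtLoc L v))
    (hRT : ∀ r ∈ R, r ∈ Subgroup.centralizer ({(γ.val : GtLoc L v)} : Set (GtLoc L v)) ∧ epsNorm (epsLoc L (splitFormGL L) v) r = 1)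
    (tT : Measure ↥T) {u : GtLoc L v} (hu : u ∈ R) {A : Set ↥T} (hA : MeasurableSet A)
    (F : ↥(Subgroup.centralizer ({(γ.val : GtLoc L v)} : Set (GtLoc L v))) → ℝ≥0∞) :
    ∫⁻ x in σ u '' A, F x ∂(∑ u' ∈ R, Measure.map (σ u') (tT.restrict {t : ↥T | IsRegularElt (((t : Gqs L v)).val : GtLoc L v)})) =
      ∫⁻ t in A ∩ {t : ↥T | IsRegularElt (((t : Gqs L v)).val : GtLoc L v)}, F (σ u t) ∂tT := by
  have hemb := fun (u' : GtLoc L v) (hu' : u' ∈ R) => measurableEmbedding_normSheet L v hT hsm hsT hsN hσ (hRT u' hu').1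
  have hAm : MeasurableSet (σ u '' A) := (hemb u hu).measurableSet_image.2 hA
  rw [← lintegral_indicator hAm, lintegral_normSheets L v hT hsm hsT hsN hσ R hRT tT, Finset.sum_eq_single_of_mem u hu]
  · -- the `u`-th sheet: `(σ_u A).indicator F ∘ σ_u = A.indicator (F ∘ σ_u)`
    have hind : ∀ t : ↥T, (σ u '' A).indicator F (σ u t) = A.indicator (F ∘ σ u) t :=
      fun t => indicator_image (normSheet_injective L v hsN hσ (hRT u hu).1)
    simp only [hind]
    rw [lintegral_indicator hA, Measure.restrict_restrict hA]
    rfl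
  · -- every other sheet misses `σ_u(A)`
    intro b hb hne
    have hdis := disjoint_range_normSheet L v hγ hsT hsN hσ (hRT u hu) (hRT b hb) (Ne.symm hne)
    have h0 : ∀ t : ↥T, (σ u '' A).indicator F (σ b t) = 0 := by
      intro t
      refine indicator_of_notMem (fun hmem => ?_) F
      obtain ⟨t', -, ht'⟩ := hmem
      exact disjoint_left.1 hdis ⟨t', rfl⟩ ⟨t, ht'.symm⟩
    simp only [h0, lintegral_zero]

/-- **`λ` IS CARRIED BY `B₀`: `λ(B₀ᶜ) = 0`** (`σ_u(T^{reg}) ⊆ B₀` for every `u ∈ R`) — ★ M2♭'s «`σ` is carried by `S₀`» on the nose for `lam := λ`, `S₀ := B₀`.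
[cite: Rogawski1990, §12.5 p. 186] -/
theorem normSheets_apply_compl_normTransversal (hns : ∀ w : PlacesOver L v, IsCMField.complexConj L • w.1 = w.1)
    [MeasurableSpace (GtLoc L v)] [BorelSpace (GtLoc L v)] [SecondCountableTopology (GtLoc L v)] [T2Space (GtLoc L v)]
    [MeasurableSpace (Gqs L v)] [BorelSpace (Gqs L v)]
    {γ : Gqs L v} {T : Subgroup (Gqs L v)} (hT : T = Subgroup.centralizer ({γ} : Set (Gqs L v))) {s : ↥T → GtLoc L v} (hsm : Measurable s)
    (hsT : ∀ t, s t ∈ Subgroup.centralizer ({(γ.val : GtLoc L v)} : Set (GtLoc L v)))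
    (hsN : ∀ t, epsNorm (epsLoc L (splitFormGL L) v) (s t) = ((t : Gqs L v)).val)
    {σ : GtLoc L v → ↥T → ↥(Subgroup.centralizer ({(γ.val : GtLoc L v)} : Set (GtLoc L v)))}
    (hσ : ∀ u ∈ Subgroup.centralizer ({(γ.val : GtLoc L v)} : Set (GtLoc L v)), ∀ t : ↥T,
      ((σ u t : ↥(Subgroup.centralizer ({(γ.val : GtLoc L v)} : Set (GtLoc L v)))) : GtLoc L v) = s t * u)
    (R : Finset (GtLoc L v))
    (hRT : ∀ r ∈ R, r ∈ Subgroup.centralizer ({(γ.val : GtLoc L v)} : Set (GtLoc L v)) ∧ epsNorm (epsLoc L (splitFormGL L) v) r = 1)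
    (tT : Measure ↥T) :
    (∑ u ∈ R, Measure.map (σ u) (tT.restrict {t : ↥T | IsRegularElt (((t : Gqs L v)).val : GtLoc L v)}))
        (⋃ u ∈ R, σ u '' {t : ↥T | IsRegularElt (((t : Gqs L v)).val : GtLoc L v)})ᶜ = 0 := by
  rw [normSheets_apply L v hns hT hsm hsT hsN hσ R hRT tT]
  refine Finset.sum_eq_zero fun u hu => ?_
  have hempty : σ u ⁻¹' (⋃ u' ∈ R, σ u' '' {t : ↥T | IsRegularElt (((t : Gqs L v)).val : GtLoc L v)})ᶜ ∩
      {t : ↥T | IsRegularElt (((t : Gqs L v)).val : GtLoc L v)} = ∅ :=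
    subset_empty_iff.1 fun t ht => (ht.1 (mem_biUnion hu ⟨t, ht.2, rfl⟩)).elim
  rw [hempty, measure_empty]

/-- **`λ` IS σ-FINITE for a σ-finite `t_T`** (finite sum of push-forwards along measurable embeddings, Mathlib `MeasurableEmbedding.sigmaFinite_map`) — ★ M2♭'s
`[SigmaFinite lam]`. [cite: Kechris1995, Thm. 15.1] -/
theorem sigmaFinite_normSheets [MeasurableSpace (GtLoc L v)] [BorelSpace (GtLoc L v)] [SecondCountableTopology (GtLoc L v)] [T2Space (GtLoc L v)]
    [MeasurableSpace (Gqs L v)] [BorelSpace (Gqs L v)]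
    {γ : Gqs L v} {T : Subgroup (Gqs L v)} (hT : T = Subgroup.centralizer ({γ} : Set (Gqs L v))) {s : ↥T → GtLoc L v} (hsm : Measurable s)
    (hsT : ∀ t, s t ∈ Subgroup.centralizer ({(γ.val : GtLoc L v)} : Set (GtLoc L v)))
    (hsN : ∀ t, epsNorm (epsLoc L (splitFormGL L) v) (s t) = ((t : Gqs L v)).val)
    {σ : GtLoc L v → ↥T → ↥(Subgroup.centralizer ({(γ.val : GtLoc L v)} : Set (GtLoc L v)))}
    (hσ : ∀ u ∈ Subgroup.centralizer ({(γ.val : GtLoc L v)} : Set (GtLoc L v)), ∀ t : ↥T,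
      ((σ u t : ↥(Subgroup.centralizer ({(γ.val : GtLoc L v)} : Set (GtLoc L v)))) : GtLoc L v) = s t * u)
    (R : Finset (GtLoc L v))
    (hRT : ∀ r ∈ R, r ∈ Subgroup.centralizer ({(γ.val : GtLoc L v)} : Set (GtLoc L v)) ∧ epsNorm (epsLoc L (splitFormGL L) v) r = 1)
    (tT : Measure ↥T) [SigmaFinite tT] :
    SigmaFinite (∑ u ∈ R, Measure.map (σ u) (tT.restrict {t : ↥T | IsRegularElt (((t : Gqs L v)).val : GtLoc L v)})) := by
  refine sigmaFinite_finsetSum R _ fun u hu => ?_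
  exact (measurableEmbedding_normSheet L v hT hsm hsT hsN hσ (hRT u hu).1).sigmaFinite_map

end Summit.HodgeConjecture.HodgeConjecture.R90.S4

end
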